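import Literature.Probability.Percolation.TriUQuadRegions
import Literature.Probability.Percolation.TriQuadCongr
import Literature.Probability.Percolation.TriQuadChain
import Literature.Probability.Percolation.HalfPlaneGoodPair
import Literature.Probability.Percolation.StoppingSetDecoupling
import HarnessLib

/-!
# One scale of the inner separation: selected stages, free-space events, decoupling

Topic `Literature/Probability/Percolation`; family `crit-perc`, statement **crit-perc.S16**
(`Literature.Probability.Percolation.triTheta_exponent`). The per-scale assembly of Kesten's arm
separation for the half-plane two-arm event at two radii, in P. Nolin's form (EJP 13 (2008),
§4.3 Lemma 12, §4.4 Lemma 15, §4.5 proof of Prop. 17 [arXiv 0711.4948: Lemma 11, Lemma 14,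
Prop. 16]), for the quad `U_{s,2s}` sitting in the half-box `[-N, N] × [0, N]`:

* `Sel`, `selStage`, `scTip`, `scSupp`, `scStop` — for a colour configuration `χ` the **selected
  stage** (the least stage whose canonical crossing avoids the examined set and is joined to the
  far boundary `uR s N`, `TriQuadChain.lean`), its tip, support and examined set;
* `FF K' M₁ χ` — the fence-frame event of the selected tip with the data of `χ` on `U` substituted
  (an increasing event of the inner half-box `I`); `rightFoot`, `Corr` — the foot rule (the
  arc-later tip takes the right foot) and the corridor; `Aev = FF χ ∩ (FF χᶜ)ᶜᵒᵐᵖˡ`,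
  `Bev = Aev ∩ corridors`; `armEv`, `Zev` — the `U`-determined frame: both arms, few stages, all
  tips protected;
* locality (`*_congr`): all of these only depend on the trace of `χ` on `uSites s N`;
* `realArm_of_colour`, `exists_goodPoint` — **deterministic synthesis**: on `Zev ∩ Bev` some window
  point is good for `ω` or for `ωᶜ` (`TriUQuadRealPoint.lean`, `HalfPlaneGoodPair.lean`);
* `key_ineq` — for separated tips, `P(Bev χ) ≥ ε³ ε'³ P(Aev χ)` (disjoint regions
  `TriUQuadRegions.lean`, Harris–FKG, RSW corridors);
* `decoupling` — **Nolin's Lemma 12 in summed form** (`StoppingSetDecoupling.lean` with the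
  constant stopping set `uSites s N`): `ε³ ε'³ · P(Zev ∩ {ω ∈ Aev ω}) ≤ P(Zev ∩ {ω ∈ Bev ω})`;
* `mem_zev_aev`, `real_zev_aev_le` — entrance from the good event, and the resulting bound by
  good points.

## References

* P. Nolin, Near-critical percolation in two dimensions, *Electron. J. Probab.* 13 (2008), §4.3
  Lemma 12, §4.4 Lemma 15, §4.5 Prop. 17 [arXiv 0711.4948: Lemma 11, Lemma 14, Prop. 16] [Nolin2008].
* H. Kesten, Scaling relations for 2D-percolation, *Comm. Math. Phys.* 109 (1987), Lemmas 2, 4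
  [KestenScalingCMP1987].

## Mathlib / tree

Tree: `exists_stage_chain_uQuad` (`TriQuadChain.lean`), `TriQuad.*_congr` (`TriQuadCongr.lean`),
`tips_far_of_prot` (`TriQuadSeparation.lean`), `openStop_subset_uLow_union` (`TriUQuadFence.lean`),
`realPoint_of_frame_corridor`, `corrOf` (`TriUQuadRealPoint.lean`), `tipRegion_disjoint`,
`determinedBy_corrOf`, `le_real_corrOf`, `isUpperSet_corrOf` (`TriUQuadRegions.lean`),
`exists_hpGood_or_compl` (`HalfPlaneGoodPair.lean`), `mul_real_mem_dataEvent_le`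
(`StoppingSetDecoupling.lean`), `determinedBy_triFrameAt`, `isUpperSet_triFrameAt`,
`nonempty_frameData`, `sitePercolation_harris'`,
`sitePercolation_real_inter_of_disjoint`, `sitePercolation_real_preimage_compl`, `real_hpGood_shift`.
-/

noncomputable section

open Set MeasureTheory

namespace Literature.Probability.Percolation

open LatticeModels

/-- The quad `U_{s,2s}`. [cite: Nolin2008, §4.4 (U-shaped regions)] -/
def uQ (s : ℕ) (hs : 1 ≤ s) : TriQuad := uQuad s (2 * s) hs (by omega)

/-! ### Selected stages and the events of a scale -/

section Defs

variable (s N : ℕ) (hs : 1 ≤ s)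

/-- **Selectable stage** `u` for the colour configuration `χ`: an inner–outer crossing of colour
`χ` avoids `N_u`, and every site of the canonical crossing of stage `u` is joined to the far
boundary `uR s N` by a `χ`-path of `U_{s,N}`. [cite: Nolin2008, §4.4, proof of Lemma 15 (arXiv 0711.4948: Lemma 14)] -/
def Sel (χ : Set (Site 2)) (u : ℕ) : Prop :=
  (uQ s hs).LRPath (χ \ ↑((uQ s hs).stages χ u)) ∧
    ∀ g ∈ (uQ s hs).canonSupport ((uQ s hs).canonSet χ u),
      ∃ b ∈ uR s N, PathIn triGraph ((↑(uSites s N) : Set (Site 2)) ∩ χ) g b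

open Classical in
/-- **The selected stage**: the least selectable stage (`0` if none). [cite: Nolin2008, §4.4, proof of Lemma 15 (arXiv 0711.4948: Lemma 14)] -/
def selStage (χ : Set (Site 2)) : ℕ := if h : ∃ u, Sel s N hs χ u then Nat.find h else 0

/-- The tip of the selected canonical crossing. [folklore] -/
def scTip (χ : Set (Site 2)) : Site 2 := (uQ s hs).canonStart ((uQ s hs).canonSet χ (selStage s N hs χ))

/-- The support of the selected canonical crossing. [folklore] -/
def scSupp (χ : Set (Site 2)) : Set (Site 2) :=
  (uQ s hs).canonSupport ((uQ s hs).canonSet χ (selStage s N hs χ))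

/-- The examined set of the selected stage. [folklore] -/
def scStop (χ : Set (Site 2)) : Finset (Site 2) := (uQ s hs).openStop χ (selStage s N hs χ)

/-- **The forcing with data substituted**: the `χ`-open sites of `U`, the examined set, and every
site off `U ∪ I`. [cite: Nolin2008, §4.3 Lemma 12 (arXiv 0711.4948: Lemma 11)] -/
def scD (χ : Set (Site 2)) : Set (Site 2) :=
  (χ ∩ ↑(uSites s (2 * s)) ∪ ↑(scStop s N hs χ)) ∪ ((↑(uSites s (2 * s)) : Set (Site 2)) ∪ uInner s)ᶜ

/-- **The fence-frame event of the selected tip**, as an event of the inner half-box: some frame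
of scale `3^i M₁`, `i < K'`, about the tip is open in `(ω ∩ I) ∪ scD χ`. [cite: Nolin2008, §4.2 Def. 6, §4.4 proof of Lemma 15 (arXiv 0711.4948: Def. 6, Lemma 14)] -/
def FF (K' M₁ : ℕ) (χ : Set (Site 2)) : Set (Set (Site 2)) :=
  {ω | ∃ i < K', (ω ∩ uInner s) ∪ scD s N hs χ ∈ triFrameAt (scTip s N hs χ) (3 ^ i * M₁)}

/-- **The foot rule**: the colour `χ` takes the right foot iff the tip of the opposite colour comes
earlier on the inner arc. [cite: Nolin2008, §4.5, proof of Prop. 17 (arXiv 0711.4948: Prop. 16)] -/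
def rightFoot (χ : Set (Site 2)) : Bool := decide (uHt s (scTip s N hs χᶜ) < uHt s (scTip s N hs χ))

/-- The corridor event of the colour `χ`. [cite: Nolin2008, §4.5, proof of Prop. 17 (arXiv 0711.4948: Prop. 16)] -/
def Corr (W A' : ℕ) (χ : Set (Site 2)) : Set (Set (Site 2)) :=
  corrOf s W A' (scTip s N hs χ) (rightFoot s N hs χ)

/-- Both fence frames present (`A⁺ ∩ A⁻` of Nolin's Lemma 12). [cite: Nolin2008, §4.3 Lemma 12 (arXiv 0711.4948: Lemma 11)] -/
def Aev (K' M₁ : ℕ) (χ : Set (Site 2)) : Set (Set (Site 2)) :=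
  FF s N hs K' M₁ χ ∩ compl ⁻¹' FF s N hs K' M₁ χᶜ

/-- Both fence frames and both corridors present (`Ã⁺ ∩ Ã⁻`). [cite: Nolin2008, §4.3 Lemma 12 (arXiv 0711.4948: Lemma 11)] -/
def Bev (K' M₁ W A' : ℕ) (χ : Set (Site 2)) : Set (Set (Site 2)) :=
  Aev s N hs K' M₁ χ ∩ (Corr s N hs W A' χ ∩ compl ⁻¹' Corr s N hs W A' χᶜ)

/-- The open inner–outer arm of `U_{s,N}`. [cite: Nolin2008, §4.6] -/
def armEv : Set (Set (Site 2)) :=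
  {ω | ∃ a ∈ uL s N, ∃ b ∈ uR s N, PathIn triGraph ((↑(uSites s N) : Set (Site 2)) ∩ ω) a b}

/-- **The frame of the scale** (determined by `U`): both arms, fewer than `2T` stages, every tip
protected at `K` scales from `M₀`. [cite: Nolin2008, §4.4, proof of Lemma 15 (arXiv 0711.4948: Lemma 14)] -/
def Zev (T K M₀ : ℕ) : Set (Set (Site 2)) :=
  (armEv s N ∩ compl ⁻¹' armEv s N) ∩
    {ω | (uQ s hs).numStages ω < 2 * T ∧ ∀ u < 2 * T, (uQ s hs).ProtO K M₀ ω u ∧ (uQ s hs).ProtO K M₀ ωᶜ u}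

end Defs

/-! ### Locality: dependence on the trace on `uSites s N` only -/

section Locality

variable {s N : ℕ} {hs : 1 ≤ s} {χ χ' : Set (Site 2)}

open Classical in
/-- `dite`/`Nat.find` only depend on the predicate. [folklore] -/
theorem dite_find_congr {P P' : ℕ → Prop} (h : P = P') :
    (if h : ∃ u, P u then Nat.find h else 0) = (if h : ∃ u, P' u then Nat.find h else 0) := by
  subst h
  rfl

/-- Agreement on `uSites s N` gives agreement on the quad (`2s ≤ N`). [folklore] -/
theorem agree_U (hN : 2 * s ≤ N) (h : ∀ v ∈ (↑(uSites s N) : Set (Site 2)), v ∈ χ ↔ v ∈ χ') :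
    ∀ v ∈ (uQ s hs).U, v ∈ χ ↔ v ∈ χ' :=
  fun v hv => h v (uSites_subset_uSites hN (Finset.mem_coe.2 hv))

/-- Agreement passes to complements. [folklore] -/
theorem agree_compl (h : ∀ v ∈ (↑(uSites s N) : Set (Site 2)), v ∈ χ ↔ v ∈ χ') :
    ∀ v ∈ (↑(uSites s N) : Set (Site 2)), v ∈ χᶜ ↔ v ∈ χ'ᶜ := fun v hv => not_congr (h v hv)

/-- The trace on `U_{s,N}`. [folklore] -/
theorem inter_eq_of_agree (h : ∀ v ∈ (↑(uSites s N) : Set (Site 2)), v ∈ χ ↔ v ∈ χ') :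
    (↑(uSites s N) : Set (Site 2)) ∩ χ = ↑(uSites s N) ∩ χ' := by
  ext v; constructor
  · rintro ⟨hv, hvχ⟩; exact ⟨hv, (h v hv).1 hvχ⟩
  · rintro ⟨hv, hvχ⟩; exact ⟨hv, (h v hv).2 hvχ⟩

/-- Selectability only depends on the trace. [folklore] -/
theorem sel_congr (hN : 2 * s ≤ N) (h : ∀ v ∈ (↑(uSites s N) : Set (Site 2)), v ∈ χ ↔ v ∈ χ') (u : ℕ) :
    Sel s N hs χ u ↔ Sel s N hs χ' u := by
  unfold Sel
  rw [TriQuad.lrPath_sdiff_stages_congr (agree_U hN h) u, TriQuad.canonSet_congr (agree_U hN h) u,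
    inter_eq_of_agree h]

/-- The selected stage only depends on the trace. [folklore] -/
theorem selStage_congr (hN : 2 * s ≤ N) (h : ∀ v ∈ (↑(uSites s N) : Set (Site 2)), v ∈ χ ↔ v ∈ χ') :
    selStage s N hs χ' = selStage s N hs χ := by
  classical
  have hP : Sel s N hs χ' = Sel s N hs χ := funext fun u => propext (sel_congr hN h u).symm
  unfold selStage
  exact dite_find_congr hP

/-- The selected tip only depends on the trace. [folklore] -/
theorem scTip_congr (hN : 2 * s ≤ N) (h : ∀ v ∈ (↑(uSites s N) : Set (Site 2)), v ∈ χ ↔ v ∈ χ') :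
    scTip s N hs χ' = scTip s N hs χ := by
  unfold scTip; rw [selStage_congr hN h, TriQuad.canonSet_congr (agree_U hN h)]

/-- The selected support only depends on the trace. [folklore] -/
theorem scSupp_congr (hN : 2 * s ≤ N) (h : ∀ v ∈ (↑(uSites s N) : Set (Site 2)), v ∈ χ ↔ v ∈ χ') :
    scSupp s N hs χ' = scSupp s N hs χ := by
  unfold scSupp; rw [selStage_congr hN h, TriQuad.canonSet_congr (agree_U hN h)]

/-- The examined set only depends on the trace. [folklore] -/
theorem scStop_congr (hN : 2 * s ≤ N) (h : ∀ v ∈ (↑(uSites s N) : Set (Site 2)), v ∈ χ ↔ v ∈ χ') :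
    scStop s N hs χ' = scStop s N hs χ := by
  unfold scStop; rw [selStage_congr hN h, TriQuad.openStop_congr (agree_U hN h)]

/-- The substituted forcing only depends on the trace. [folklore] -/
theorem scD_congr (hN : 2 * s ≤ N) (h : ∀ v ∈ (↑(uSites s N) : Set (Site 2)), v ∈ χ ↔ v ∈ χ') :
    scD s N hs χ' = scD s N hs χ := by
  have hU : χ' ∩ (↑(uSites s (2 * s)) : Set (Site 2)) = χ ∩ ↑(uSites s (2 * s)) := by
    ext v; constructor
    · rintro ⟨hvχ, hv⟩; exact ⟨(h v (uSites_subset_uSites hN hv)).2 hvχ, hv⟩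
    · rintro ⟨hvχ, hv⟩; exact ⟨(h v (uSites_subset_uSites hN hv)).1 hvχ, hv⟩
  unfold scD; rw [scStop_congr hN h, hU]

/-- The fence-frame event only depends on the trace. [folklore] -/
theorem ff_congr (hN : 2 * s ≤ N) (h : ∀ v ∈ (↑(uSites s N) : Set (Site 2)), v ∈ χ ↔ v ∈ χ') (K' M₁ : ℕ) :
    FF s N hs K' M₁ χ' = FF s N hs K' M₁ χ := by
  unfold FF; rw [scD_congr hN h, scTip_congr hN h]

/-- The foot only depends on the trace. [folklore] -/
theorem rightFoot_congr (hN : 2 * s ≤ N) (h : ∀ v ∈ (↑(uSites s N) : Set (Site 2)), v ∈ χ ↔ v ∈ χ') :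
    rightFoot s N hs χ' = rightFoot s N hs χ := by
  unfold rightFoot; rw [scTip_congr hN h, scTip_congr hN (agree_compl h)]

/-- The corridor event only depends on the trace. [folklore] -/
theorem corr_congr (hN : 2 * s ≤ N) (h : ∀ v ∈ (↑(uSites s N) : Set (Site 2)), v ∈ χ ↔ v ∈ χ') (W A' : ℕ) :
    Corr s N hs W A' χ' = Corr s N hs W A' χ := by
  unfold Corr; rw [scTip_congr hN h, rightFoot_congr hN h]

/-- `Aev` only depends on the trace. [folklore] -/
theorem aev_congr (hN : 2 * s ≤ N) (h : ∀ v ∈ (↑(uSites s N) : Set (Site 2)), v ∈ χ ↔ v ∈ χ') (K' M₁ : ℕ) :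
    Aev s N hs K' M₁ χ' = Aev s N hs K' M₁ χ := by
  unfold Aev; rw [ff_congr hN h, ff_congr hN (agree_compl h)]

/-- `Bev` only depends on the trace. [folklore] -/
theorem bev_congr (hN : 2 * s ≤ N) (h : ∀ v ∈ (↑(uSites s N) : Set (Site 2)), v ∈ χ ↔ v ∈ χ')
    (K' M₁ W A' : ℕ) : Bev s N hs K' M₁ W A' χ' = Bev s N hs K' M₁ W A' χ := by
  unfold Bev; rw [aev_congr hN h, corr_congr hN h, corr_congr hN (agree_compl h)]

/-- The arm event only depends on the trace. [folklore] -/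
theorem mem_armEv_congr (h : ∀ v ∈ (↑(uSites s N) : Set (Site 2)), v ∈ χ ↔ v ∈ χ') :
    χ ∈ armEv s N ↔ χ' ∈ armEv s N := by
  unfold armEv; simp only [mem_setOf_eq, inter_eq_of_agree h]

/-- `Zev` only depends on the trace. [folklore] -/
theorem mem_zev_congr (hN : 2 * s ≤ N) (h : ∀ v ∈ (↑(uSites s N) : Set (Site 2)), v ∈ χ ↔ v ∈ χ')
    (T K M₀ : ℕ) : χ ∈ Zev s N hs T K M₀ ↔ χ' ∈ Zev s N hs T K M₀ := by
  unfold Zev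
  simp only [mem_inter_iff, mem_preimage, mem_setOf_eq, mem_armEv_congr h, mem_armEv_congr (agree_compl h),
    TriQuad.numStages_congr (agree_U hN h)]
  have h1 : ∀ u, (uQ s hs).ProtO K M₀ χ u ↔ (uQ s hs).ProtO K M₀ χ' u := fun u => TriQuad.protO_congr (agree_U hN h)
  have h2 : ∀ u, (uQ s hs).ProtO K M₀ χᶜ u ↔ (uQ s hs).ProtO K M₀ χ'ᶜ u :=
    fun u => TriQuad.protO_congr (TriQuad.compl_agree (agree_U hN h))
  simp only [h1, h2]

end Locality

/-! ### Deterministic synthesis -/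

section Deterministic

variable {s N : ℕ} {hs : 1 ≤ s} {χ : Set (Site 2)}

/-- **An arm selects a stage**: the selected stage is selectable and is a genuine stage. [cite: Nolin2008, §4.4, proof of Lemma 15 (arXiv 0711.4948: Lemma 14)] -/
theorem sel_selStage (hN : 2 * s ≤ N) (harm : χ ∈ armEv s N) :
    Sel s N hs χ (selStage s N hs χ) ∧ selStage s N hs χ < (uQ s hs).numStages χ := by
  classical
  obtain ⟨a, ha, b, hb, hp⟩ := harm
  obtain ⟨u, hu, hlr, hchain⟩ := exists_stage_chain_uQuad hs (by omega) hN ha hb hp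
  have hex : ∃ u, Sel s N hs χ u := ⟨u, hlr, hchain⟩
  have hsel : selStage s N hs χ = Nat.find hex := by
    unfold selStage; rw [dif_pos hex]
  rw [hsel]
  exact ⟨Nat.find_spec hex, lt_of_le_of_lt (Nat.find_min' hex ⟨hlr, hchain⟩) hu⟩

/-- **Facts about the selected canonical crossing**: tip on the inner arc, support inside
`U ∩ χ` joined from the tip to the outer boundary and meeting the arc only at the tip, examined set
low or on the support. [cite: Nolin2008, §4.4, proof of Lemma 15 (arXiv 0711.4948: Lemma 14)] -/
theorem canon_facts (hlr : (uQ s hs).LRPath (χ \ ↑((uQ s hs).stages χ (selStage s N hs χ)))) :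
    scTip s N hs χ ∈ uL s (2 * s) ∧ scSupp s N hs χ ⊆ ↑(uSites s (2 * s)) ∧ scSupp s N hs χ ⊆ χ ∧
      (∃ y ∈ uR s (2 * s), PathIn triGraph (scSupp s N hs χ) (scTip s N hs χ) y) ∧
      (∀ z ∈ scSupp s N hs χ, z ∈ uL s (2 * s) → z = scTip s N hs χ) ∧
      (↑(scStop s N hs χ) : Set (Site 2)) ⊆ uLow s (2 * s) (scSupp s N hs χ) ∪ scSupp s N hs χ := by
  obtain ⟨x, hx, y₀, hy₀, hp₀⟩ := TriQuad.exists_crossing_canonSet hlr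
  have hcan := TriQuad.hasCanon_of_pathIn hx hy₀ hp₀
  obtain ⟨hlL, hSγS, hy, -, honly⟩ := TriQuad.canonSupport_spec hcan
  exact ⟨hlL, fun v hv => (hSγS hv).1.1, fun v hv => (hSγS hv).1.2.1, hy, honly,
    openStop_subset_uLow_union hs (by omega) hlr⟩

/-- **The substituted forcing is the real forcing** for configurations with the given trace. [cite: Nolin2008, §4.3 Lemma 12 (arXiv 0711.4948: Lemma 11)] -/
theorem forced_eq {ω : Set (Site 2)} (hagree : ∀ v ∈ (↑(uSites s (2 * s)) : Set (Site 2)), v ∈ ω ↔ v ∈ χ) :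
    (ω ∩ uInner s) ∪ scD s N hs χ =
      ω ∪ (↑(scStop s N hs χ) ∪ ((↑(uSites s (2 * s)) : Set (Site 2)) ∪ uInner s)ᶜ) := by
  ext v
  simp only [scD, mem_union, mem_inter_iff, mem_compl_iff]
  constructor
  · rintro (⟨hω, -⟩ | (⟨hχ, hU⟩ | hst) | hout)
    · exact Or.inl hω
    · exact Or.inl ((hagree v hU).2 hχ)
    · exact Or.inr (Or.inl hst)
    · exact Or.inr (Or.inr hout)
  · rintro (hω | hst | hout)
    · by_cases hU : v ∈ (↑(uSites s (2 * s)) : Set (Site 2))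
      · exact Or.inr (Or.inl (Or.inl ⟨(hagree v hU).1 hω, hU⟩))
      · by_cases hI : v ∈ uInner s
        · exact Or.inl ⟨hω, hI⟩
        · exact Or.inr (Or.inr fun h' => h'.elim hU hI)
    · exact Or.inr (Or.inl (Or.inr hst))
    · exact Or.inr (Or.inr hout)

/-- **One colour: arm + fence frame + corridor ⇒ a real arm from the window.** [cite: Nolin2008, §4.4 proof of Lemma 15, §4.5 proof of Prop. 17 (arXiv 0711.4948: Lemma 14, Prop. 16)] -/
theorem realArm_of_colour {K' M₁ W A : ℕ} (hN : 2 * s ≤ N) (hW : 2 ≤ W) (hWM : W ≤ M₁)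
    (hA : 2 * 3 ^ (K' - 1) * M₁ ≤ A) (hsA : 4 * A + 2 * W + 8 ≤ s)
    (harm : χ ∈ armEv s N) (hFF : χ ∈ FF s N hs K' M₁ χ) {f : Bool}
    (hcorr : χ ∈ corrOf s W (A + W) (scTip s N hs χ) f) :
    ∃ x : Site 2, x 1 = 0 ∧ -(s : ℤ) + 1 ≤ x 0 ∧ x 0 ≤ s + A ∧
      ∃ b ∈ uR s N, PathIn triGraph (((↑(uSites s N) : Set (Site 2)) ∪ uInner s) ∩ χ) x b := by
  obtain ⟨hsel, -⟩ := sel_selStage (hs := hs) hN harm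
  obtain ⟨hlL, hSU, hSχ, ⟨y, hy, hpγ⟩, honly, hP₀⟩ := canon_facts hsel.1
  obtain ⟨i, hi, hfr⟩ := hFF
  rw [forced_eq (χ := χ) (fun v _ => Iff.rfl)] at hfr
  obtain ⟨F⟩ := nonempty_frameData hfr
  have h3 : 1 ≤ 3 ^ i := Nat.one_le_pow _ _ (by norm_num)
  have h3' : 3 ^ i ≤ 3 ^ (K' - 1) := Nat.pow_le_pow_right (by norm_num) (by omega)
  have hWM' : W ≤ 3 ^ i * M₁ := hWM.trans (Nat.le_mul_of_pos_left _ h3)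
  have hMA : 2 * (3 ^ i * M₁) ≤ A := le_trans (by nlinarith) hA
  obtain ⟨x, hx1, hx0, hx0', g, hg, hpath⟩ := realPoint_of_frame_corridor (Nq := 2 * s) hs (by omega) hSU hSχ hP₀
    honly hlL hy hpγ hW hWM' hMA hsA (by omega) F hcorr
  obtain ⟨b, hb, hq⟩ := hsel.2 g hg
  refine ⟨x, hx1, hx0, by omega, b, hb, (hpath.mono ?_).trans (hq.mono ?_)⟩
  · rintro v ⟨hvχ, hv | hv⟩
    · exact ⟨Or.inl (uSites_subset_uSites hN hv), hvχ⟩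
    · exact ⟨Or.inr hv, hvχ⟩
  · rintro v ⟨hv, hvχ⟩; exact ⟨Or.inl hv, hvχ⟩

/-- **Both colours: a good or an anti-good window point.** On the two arms and `Bev`, with
`N = 2M'` and `s + A + 1 < M'`, some `(x₀, 0)` with `|x₀| ≤ s + A` is `M'`-good for `ω` or for
`ωᶜ`. [cite: Nolin2008, §4.5, proof of Prop. 17 (arXiv 0711.4948: Prop. 16)] [cite: KestenScalingCMP1987, Lemma 4] -/
theorem exists_goodPoint {K' M₁ W A M' : ℕ} {ω : Set (Site 2)} (hNM : N = 2 * M') (hN : 2 * s ≤ N)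
    (hW : 2 ≤ W) (hWM : W ≤ M₁) (hA : 2 * 3 ^ (K' - 1) * M₁ ≤ A) (hsA : 4 * A + 2 * W + 8 ≤ s)
    (hM' : s + A + 1 < M') (harm : ω ∈ armEv s N) (harmc : ωᶜ ∈ armEv s N)
    (hB : ω ∈ Bev s N hs K' M₁ W (A + W) ω) :
    ∃ x₀ : ℤ, -((s : ℤ) + A) ≤ x₀ ∧ x₀ ≤ s + A ∧ (ω ∈ hpGood M' ![x₀, 0] ∨ ωᶜ ∈ hpGood M' ![x₀, 0]) := by
  obtain ⟨⟨hFo, hFc⟩, hCo, hCc⟩ := hB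
  rw [mem_preimage] at hFc hCc
  obtain ⟨xo, hxo1, hxo0, hxo0', bo, hbo, hpo⟩ := realArm_of_colour hN hW hWM hA hsA harm hFo hCo
  obtain ⟨xc, hxc1, hxc0, hxc0', bc, hbc, hpc⟩ := realArm_of_colour hN hW hWM hA hsA harmc hFc hCc
  have hNz : (N : ℤ) = 2 * M' := by exact_mod_cast hNM
  have sub : ∀ χ : Set (Site 2), ((↑(uSites s N) : Set (Site 2)) ∪ uInner s) ∩ χ ⊆ hpBox M' ∩ χ := by
    rintro χ v ⟨hv | hv, hvχ⟩
    · have := (mem_coe_uSites.1 hv).1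
      exact ⟨mem_hpBox.2 ⟨by omega, by omega, by omega, by omega⟩, hvχ⟩
    · have := mem_uInner.1 hv
      have hs2 : (2 * s : ℤ) ≤ N := by exact_mod_cast hN
      exact ⟨mem_hpBox.2 ⟨by omega, by omega, by omega, by omega⟩, hvχ⟩
  have outer : ∀ b ∈ uR s N, b ∈ hpOuter M' := by
    rintro b ⟨-, hb⟩
    rw [mem_hpOuter]
    rcases hb with h | h | h
    · exact Or.inl (by omega)
    · exact Or.inr (Or.inl (by omega))
    · exact Or.inr (Or.inr (by omega))
  exact exists_hpGood_or_compl (L := (s : ℤ) + A) (by omega) hxo1 hxc1 (by omega) hxo0' (by omega) hxc0'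
    (outer bo hbo) (outer bc hbc) (hpo.mono (sub ω)) (hpc.mono (sub ωᶜ))

/-- **Entrance from the good event**: the two arms, few stages, protection at every stage and the
fence frames at the selected stages put `ω` in `Zev ∩ {ω ∈ Aev ω}`. [cite: Nolin2008, §4.4, proof of Lemma 15 (arXiv 0711.4948: Lemma 14)] -/
theorem mem_zev_aev {T K M₀ K' M₁ : ℕ} {ω : Set (Site 2)}
    (harm : ω ∈ armEv s N) (harmc : ωᶜ ∈ armEv s N) (hT : (uQ s hs).numStages ω < 2 * T)
    (hprot : ∀ u < 2 * T, (uQ s hs).ProtO K M₀ ω u ∧ (uQ s hs).ProtO K M₀ ωᶜ u)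
    (hPE : (uQ s hs).ProtOE (uInner s) K' M₁ ω (selStage s N hs ω))
    (hPEc : (uQ s hs).ProtOE (uInner s) K' M₁ ωᶜ (selStage s N hs ωᶜ)) :
    ω ∈ Zev s N hs T K M₀ ∩ {ω | ω ∈ Aev s N hs K' M₁ ω} := by
  refine ⟨⟨⟨harm, harmc⟩, hT, hprot⟩, ?_, ?_⟩
  · obtain ⟨i, hi, h⟩ := hPE
    refine ⟨i, hi, ?_⟩
    rw [forced_eq (χ := ω) (fun v _ => Iff.rfl)]
    exact h
  · obtain ⟨i, hi, h⟩ := hPEc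
    rw [mem_preimage]
    refine ⟨i, hi, ?_⟩
    rw [forced_eq (χ := ωᶜ) (fun v _ => Iff.rfl)]
    exact h

end Deterministic

/-! ### Probability -/

section Probability

variable {s N : ℕ} {hs : 1 ≤ s}

/-- The inner half-box as a finite set of sites. [folklore] -/
def uInnerFinset (s : ℕ) : Finset (Site 2) := triStripFinset (-(s : ℤ) + 1) 0 (2 * (s - 1)) (s - 1)

/-- The finite inner half-box has underlying set `uInner s`. [folklore] -/
theorem coe_uInnerFinset (hs : 1 ≤ s) : (↑(uInnerFinset s) : Set (Site 2)) = uInner s := by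
  ext z
  rw [uInnerFinset, coe_triStripFinset, mem_triStrip, mem_uInner]
  omega

/-- The fence-frame event is increasing. [folklore] -/
theorem isUpperSet_FF (K' M₁ : ℕ) (χ : Set (Site 2)) : IsUpperSet (FF s N hs K' M₁ χ) := by
  rintro ω ω' hle ⟨i, hi, h⟩
  exact ⟨i, hi, isUpperSet_triFrameAt _ _ (union_subset_union_left _ (inter_subset_inter_left _ hle)) h⟩

/-- The fence-frame event is an event of the inner half-box. [folklore] -/
theorem determinedBy_FF_uInner (K' M₁ : ℕ) (χ : Set (Site 2)) :
    DeterminedBy (FF s N hs K' M₁ χ) (uInner s) := by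
  rw [determinedBy_iff]; intro ω ω' h
  simp only [FF, mem_setOf_eq, h]

/-- **Locality of the fence-frame event**: it is determined by the sites of `I` in the box of reach
`A ≥ 2 · 3^{K'-1} M₁` about the selected tip. [cite: Nolin2008, §4.3 Lemma 12 (arXiv 0711.4948: Lemma 11)] -/
theorem determinedBy_FF_box {K' M₁ A : ℕ} (hA : 2 * 3 ^ (K' - 1) * M₁ ≤ A) (χ : Set (Site 2)) :
    DeterminedBy (FF s N hs K' M₁ χ)
      (uInner s ∩ boxZ (scTip s N hs χ 0 - A) (scTip s N hs χ 0 + A) (scTip s N hs χ 1 - A) (scTip s N hs χ 1 + A)) := by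
  rw [determinedBy_iff]
  intro ω ω' h
  simp only [FF, mem_setOf_eq]
  refine exists_congr fun i => and_congr_right fun hi => ?_
  have hM : 2 * ((3 ^ i * M₁ : ℕ) : ℤ) ≤ A := by
    have h3' : 3 ^ i ≤ 3 ^ (K' - 1) := Nat.pow_le_pow_right (by norm_num) (by omega)
    have : 2 * (3 ^ i * M₁) ≤ A := le_trans (by nlinarith) hA
    exact_mod_cast this
  apply (determinedBy_iff _ _).1 (determinedBy_triFrameAt (scTip s N hs χ) (3 ^ i * M₁))
  have key : ∀ {ω ω' : Set (Site 2)}, ω ∩ (uInner s ∩ boxZ (scTip s N hs χ 0 - A) (scTip s N hs χ 0 + A)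
      (scTip s N hs χ 1 - A) (scTip s N hs χ 1 + A)) = ω' ∩ (uInner s ∩ boxZ (scTip s N hs χ 0 - A)
      (scTip s N hs χ 0 + A) (scTip s N hs χ 1 - A) (scTip s N hs χ 1 + A)) →
      (ω ∩ uInner s ∪ scD s N hs χ) ∩ ↑(triSqAnnulusFinset (scTip s N hs χ) (3 ^ i * M₁) (2 * (3 ^ i * M₁))) ⊆
        (ω' ∩ uInner s ∪ scD s N hs χ) ∩ ↑(triSqAnnulusFinset (scTip s N hs χ) (3 ^ i * M₁) (2 * (3 ^ i * M₁))) := by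
    intro ω ω' h
    rintro v ⟨hv, hann⟩
    refine ⟨?_, hann⟩
    rcases hv with ⟨hvω, hvI⟩ | hvD
    · left
      have hb := (mem_triSqAnnulusFinset.1 (Finset.mem_coe.1 hann)).1
      have : v ∈ ω' ∩ (uInner s ∩ boxZ (scTip s N hs χ 0 - A) (scTip s N hs χ 0 + A)
          (scTip s N hs χ 1 - A) (scTip s N hs χ 1 + A)) := by
        rw [← h]; exact ⟨hvω, hvI, mem_boxZ.2 ⟨by omega, by omega, by omega, by omega⟩⟩
      exact ⟨this.1, hvI⟩
    · exact Or.inr hvD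
  exact Subset.antisymm (key h) (key h.symm)

/-- The fence-frame event is determined by the region of the tip. [folklore] -/
theorem determinedBy_FF_region {K' M₁ W A A' : ℕ} (hA : 2 * 3 ^ (K' - 1) * M₁ ≤ A) (χ : Set (Site 2)) (f : Bool) :
    DeterminedBy (FF s N hs K' M₁ χ) (tipRegion s W A A' (scTip s N hs χ) f) :=
  (determinedBy_FF_box hA χ).mono fun _ hv => ⟨hv.1, Or.inl hv.2⟩

/-- The corridor event is determined by the region of the tip. [folklore] -/
theorem determinedBy_corr_region {W A A' : ℕ} (hW : 1 ≤ W) (hWs : 2 * W + 1 ≤ s) (hWA' : 2 * W ≤ A')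
    (hA's : A' + W + 1 ≤ s) {χ : Set (Site 2)} (hl : scTip s N hs χ ∈ uL s (2 * s)) :
    DeterminedBy (Corr s N hs W A' χ) (tipRegion s W A A' (scTip s N hs χ) (rightFoot s N hs χ)) :=
  (determinedBy_corrOf hs (by omega) hW hWs hWA' hA's hl _).mono fun _ hv => ⟨hv.1, Or.inr hv.2⟩

/-- The tips of a configuration of the frame lie on the inner arc and are distinct. [folklore] -/
theorem tips_of_zev {T K M₀ : ℕ} (hN : 2 * s ≤ N) {χ : Set (Site 2)} (hχ : χ ∈ Zev s N hs T K M₀) :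
    scTip s N hs χ ∈ uL s (2 * s) ∧ scTip s N hs χᶜ ∈ uL s (2 * s) ∧ scTip s N hs χ ≠ scTip s N hs χᶜ := by
  obtain ⟨⟨harm, harmc⟩, -, -⟩ := hχ
  rw [mem_preimage] at harmc
  obtain ⟨hselo, -⟩ := sel_selStage (hs := hs) hN harm
  obtain ⟨hselc, -⟩ := sel_selStage (hs := hs) hN harmc
  obtain ⟨hlo, -, hSo, ⟨yo, -, hpo⟩, -, -⟩ := canon_facts hselo.1
  obtain ⟨hlc, -, hSc, ⟨yc, -, hpc⟩, -, -⟩ := canon_facts hselc.1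
  exact ⟨hlo, hlc, fun heq => (hSc hpc.left_mem) (heq ▸ hSo hpo.left_mem)⟩

/-- **The key inequality for separated tips** (Nolin's Lemma 12 for one value of the data): if
the two selected tips lie on the inner arc, are distinct, and the closed one is outside the
`M₀`-box of the open one (`M₀ ≥ 2(A+W) + 2W + 2`), then
`P_p(Bev χ) ≥ ε³ ε'³ P_p(Aev χ)` where `ε, ε'` are the band constants at `p` and `1 - p`:
the open fence frame and corridor live in the region of the open tip, the closed ones in the
disjoint region of the closed tip (independence), and within each region Harris–FKG applies. [cite: Nolin2008, §4.3 Lemma 12, §4.5 proof of Prop. 17 (arXiv 0711.4948: Lemma 11, Prop. 16)] -/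
theorem key_ineq (p : unitInterval) {K' M₁ W A M₀ h j : ℕ} {δ₁ δ₂ δ₁' δ₂' : ℝ}
    (hδ₁ : 0 ≤ δ₁) (hδ₂ : 0 ≤ δ₂) (h₁ : δ₁ ≤ triLRCrossingProb p (2 * h) h)
    (h₂ : δ₂ ≤ triLRCrossingProb p h h) (hδ₁' : 0 ≤ δ₁') (hδ₂' : 0 ≤ δ₂')
    (h₁' : δ₁' ≤ triLRCrossingProb (unitInterval.symm p) (2 * h) h)
    (h₂' : δ₂' ≤ triLRCrossingProb (unitInterval.symm p) h h) (hj : 1 ≤ j)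
    (hWh : W = h + 1) (hjs : 2 * s ≤ (j + 1) * h) (hWA : W ≤ A) (hA : 2 * 3 ^ (K' - 1) * M₁ ≤ A)
    (hM₀ : 2 * (A + W) + 2 * W + 2 ≤ M₀) (hsA : 4 * A + 2 * W + 8 ≤ s)
    {χ : Set (Site 2)} (hlo : scTip s N hs χ ∈ uL s (2 * s)) (hlc : scTip s N hs χᶜ ∈ uL s (2 * s))
    (hne : scTip s N hs χ ≠ scTip s N hs χᶜ) (hfar : ¬ TriQuad.InBox (scTip s N hs χ) M₀ (scTip s N hs χᶜ)) :
    (δ₁ ^ j * δ₂ ^ (j - 1)) ^ 3 * (δ₁' ^ j * δ₂' ^ (j - 1)) ^ 3 *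
        (triSitePercolation p).real (Aev s N hs K' M₁ χ) ≤
      (triSitePercolation p).real (Bev s N hs K' M₁ W (A + W) χ) := by
  classical
  have hW1 : 1 ≤ W := by omega
  have hs2 : s + 1 ≤ 2 * s := by omega
  -- the feet
  have huo := (arcPt_uHt hs hs2 hlo).1
  have huc := (arcPt_uHt hs hs2 hlc).1
  have hneq : uHt s (scTip s N hs χ) ≠ uHt s (scTip s N hs χᶜ) := fun heq => hne (by rw [← huo, ← huc, heq])
  have hAA' : A ≤ A + W := by omega
  have hA's : A + W + W + 2 ≤ s := by omega
  -- the regions are disjoint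
  have hdisj : Disjoint (tipRegion s W A (A + W) (scTip s N hs χ) (rightFoot s N hs χ))
      (tipRegion s W A (A + W) (scTip s N hs χᶜ) (rightFoot s N hs χᶜ)) := by
    rcases lt_or_gt_of_ne hneq with hlt | hlt
    · have hfo : rightFoot s N hs χ = false := by
        unfold rightFoot; exact decide_eq_false (not_lt.2 hlt.le)
      have hfc' : rightFoot s N hs χᶜ = true := by
        unfold rightFoot; rw [compl_compl]; exact decide_eq_true hlt
      rw [hfo, hfc']
      exact tipRegion_disjoint (A' := A + W) hs hs2 hW1 hWA hAA' hM₀ hA's hlo hlc hlt hfar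
    · have hfo : rightFoot s N hs χ = true := by
        unfold rightFoot; exact decide_eq_true hlt
      have hfc' : rightFoot s N hs χᶜ = false := by
        unfold rightFoot; rw [compl_compl]; exact decide_eq_false (not_lt.2 hlt.le)
      have hfar' : ¬ TriQuad.InBox (scTip s N hs χᶜ) M₀ (scTip s N hs χ) := by
        unfold TriQuad.InBox at hfar ⊢; omega
      rw [hfo, hfc']
      exact (tipRegion_disjoint (A' := A + W) hs hs2 hW1 hWA hAA' hM₀ hA's hlc hlo hlt hfar').symm
  -- the finite supports
  set So : Finset (Site 2) := (uInnerFinset s).filter fun v =>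
    v ∈ tipRegion s W A (A + W) (scTip s N hs χ) (rightFoot s N hs χ) with hSo
  set Sc : Finset (Site 2) := (uInnerFinset s).filter fun v =>
    v ∈ tipRegion s W A (A + W) (scTip s N hs χᶜ) (rightFoot s N hs χᶜ) with hSc
  have cSo : (↑So : Set (Site 2)) = tipRegion s W A (A + W) (scTip s N hs χ) (rightFoot s N hs χ) := by
    ext v
    rw [hSo, Finset.coe_filter]
    simp only [mem_setOf_eq]
    rw [← Finset.mem_coe, coe_uInnerFinset hs]
    exact ⟨fun h0 => h0.2, fun h0 => ⟨h0.1, h0⟩⟩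
  have cSc : (↑Sc : Set (Site 2)) = tipRegion s W A (A + W) (scTip s N hs χᶜ) (rightFoot s N hs χᶜ) := by
    ext v
    rw [hSc, Finset.coe_filter]
    simp only [mem_setOf_eq]
    rw [← Finset.mem_coe, coe_uInnerFinset hs]
    exact ⟨fun h0 => h0.2, fun h0 => ⟨h0.1, h0⟩⟩
  have hdisjS : Disjoint So Sc := by rw [← Finset.disjoint_coe, cSo, cSc]; exact hdisj
  -- locality of the four events
  have dFF : DeterminedBy (FF s N hs K' M₁ χ) ↑So := by rw [cSo]; exact determinedBy_FF_region hA χ _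
  have dCo : DeterminedBy (Corr s N hs W (A + W) χ) ↑So := by
    rw [cSo]; exact determinedBy_corr_region hW1 (by omega) (by omega) (by omega) hlo
  have dFFc' : DeterminedBy (FF s N hs K' M₁ χᶜ) ↑Sc := by rw [cSc]; exact determinedBy_FF_region hA χᶜ _
  have dCc' : DeterminedBy (Corr s N hs W (A + W) χᶜ) ↑Sc := by
    rw [cSc]; exact determinedBy_corr_region hW1 (by omega) (by omega) (by omega) hlc
  have dFFc : DeterminedBy (compl ⁻¹' FF s N hs K' M₁ χᶜ) ↑Sc := determinedBy_compl_mem dFFc'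
  have dCc : DeterminedBy (compl ⁻¹' Corr s N hs W (A + W) χᶜ) ↑Sc := determinedBy_compl_mem dCc'
  -- monotonicity
  have uFF := isUpperSet_FF (hs := hs) (N := N) K' M₁ χ
  have uCo : IsUpperSet (Corr s N hs W (A + W) χ) := isUpperSet_corrOf _ _ _ _ _
  have uFFc := isUpperSet_FF (hs := hs) (N := N) K' M₁ χᶜ
  have uCc : IsUpperSet (Corr s N hs W (A + W) χᶜ) := isUpperSet_corrOf _ _ _ _ _
  -- corridor probabilities
  have eo : (δ₁ ^ j * δ₂ ^ (j - 1)) ^ 3 ≤ (triSitePercolation p).real (Corr s N hs W (A + W) χ) :=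
    le_real_corrOf (A' := A + W) p hδ₁ hδ₂ h₁ h₂ hj hWh hjs (by omega) (by omega) (by omega) hs hs2 hlo _
  have ec : (δ₁' ^ j * δ₂' ^ (j - 1)) ^ 3 ≤ (triSitePercolation p).real (compl ⁻¹' Corr s N hs W (A + W) χᶜ) := by
    have := le_real_corrOf (A' := A + W) (unitInterval.symm p) hδ₁' hδ₂' h₁' h₂' hj hWh hjs (by omega) (by omega)
      (by omega) hs hs2 hlc (rightFoot s N hs χᶜ)
    unfold triSitePercolation at this ⊢
    rw [sitePercolation_real_preimage_compl]
    exact this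
  -- assemble
  unfold triSitePercolation at eo ec ⊢
  have e1 : (sitePercolation (Site 2) p).real (Bev s N hs K' M₁ W (A + W) χ) =
      (sitePercolation (Site 2) p).real (FF s N hs K' M₁ χ ∩ Corr s N hs W (A + W) χ) *
        (sitePercolation (Site 2) p).real (compl ⁻¹' FF s N hs K' M₁ χᶜ ∩ compl ⁻¹' Corr s N hs W (A + W) χᶜ) := by
    have : Bev s N hs K' M₁ W (A + W) χ = (FF s N hs K' M₁ χ ∩ Corr s N hs W (A + W) χ) ∩
        (compl ⁻¹' FF s N hs K' M₁ χᶜ ∩ compl ⁻¹' Corr s N hs W (A + W) χᶜ) := by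
      simp only [Bev, Aev]; exact inter_inter_inter_comm _ _ _ _
    rw [this]
    exact sitePercolation_real_inter_of_disjoint p (dFF.inter dCo) (dFFc.inter dCc) hdisjS
  have e2 := sitePercolation_harris' p dFF dCo uFF uCo
  have e3 : (sitePercolation (Site 2) p).real (compl ⁻¹' FF s N hs K' M₁ χᶜ) *
      (sitePercolation (Site 2) p).real (compl ⁻¹' Corr s N hs W (A + W) χᶜ) ≤
        (sitePercolation (Site 2) p).real (compl ⁻¹' FF s N hs K' M₁ χᶜ ∩ compl ⁻¹' Corr s N hs W (A + W) χᶜ) := by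
    rw [← preimage_inter, sitePercolation_real_preimage_compl, sitePercolation_real_preimage_compl,
      sitePercolation_real_preimage_compl]
    exact sitePercolation_harris' (unitInterval.symm p) dFFc' dCc' uFFc uCc
  have e4 : (sitePercolation (Site 2) p).real (Aev s N hs K' M₁ χ) =
      (sitePercolation (Site 2) p).real (FF s N hs K' M₁ χ) *
        (sitePercolation (Site 2) p).real (compl ⁻¹' FF s N hs K' M₁ χᶜ) :=
    sitePercolation_real_inter_of_disjoint p dFF dFFc hdisjS
  rw [e1, e4]
  have n1 : 0 ≤ (δ₁ ^ j * δ₂ ^ (j - 1)) ^ 3 := by positivity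
  have n2 : 0 ≤ (δ₁' ^ j * δ₂' ^ (j - 1)) ^ 3 := by positivity
  calc (δ₁ ^ j * δ₂ ^ (j - 1)) ^ 3 * (δ₁' ^ j * δ₂' ^ (j - 1)) ^ 3 *
        ((sitePercolation (Site 2) p).real (FF s N hs K' M₁ χ) *
          (sitePercolation (Site 2) p).real (compl ⁻¹' FF s N hs K' M₁ χᶜ))
      = ((sitePercolation (Site 2) p).real (FF s N hs K' M₁ χ) * (δ₁ ^ j * δ₂ ^ (j - 1)) ^ 3) *
          ((sitePercolation (Site 2) p).real (compl ⁻¹' FF s N hs K' M₁ χᶜ) * (δ₁' ^ j * δ₂' ^ (j - 1)) ^ 3) := by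
        ring
    _ ≤ ((sitePercolation (Site 2) p).real (FF s N hs K' M₁ χ) *
            (sitePercolation (Site 2) p).real (Corr s N hs W (A + W) χ)) *
          ((sitePercolation (Site 2) p).real (compl ⁻¹' FF s N hs K' M₁ χᶜ) *
            (sitePercolation (Site 2) p).real (compl ⁻¹' Corr s N hs W (A + W) χᶜ)) :=
        mul_le_mul (mul_le_mul_of_nonneg_left eo measureReal_nonneg)
          (mul_le_mul_of_nonneg_left ec measureReal_nonneg) (mul_nonneg measureReal_nonneg n2)
          (mul_nonneg measureReal_nonneg measureReal_nonneg)
    _ ≤ _ := mul_le_mul e2 e3 (mul_nonneg measureReal_nonneg measureReal_nonneg) measureReal_nonneg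

open Classical in
/-- The data event `1{η ∈ Zev} · Aev η` of the decoupling (for the constant stopping set
`uSites s N`; `∅` for any other value of the examined set). [cite: Nolin2008, §4.3 Lemma 12 (arXiv 0711.4948: Lemma 11)] -/
def dataA (s N : ℕ) (hs : 1 ≤ s) (T K M₀ K' M₁ : ℕ) (F η : Finset (Site 2)) : Set (Set (Site 2)) :=
  if F = uSites s N then (if (↑η : Set (Site 2)) ∈ Zev s N hs T K M₀ then Aev s N hs K' M₁ ↑η else ∅) else ∅

open Classical in
/-- The data event `1{η ∈ Zev} · Bev η`. [cite: Nolin2008, §4.3 Lemma 12 (arXiv 0711.4948: Lemma 11)] -/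
def dataB (s N : ℕ) (hs : 1 ≤ s) (T K M₀ K' M₁ W A' : ℕ) (F η : Finset (Site 2)) : Set (Set (Site 2)) :=
  if F = uSites s N then (if (↑η : Set (Site 2)) ∈ Zev s N hs T K M₀ then Bev s N hs K' M₁ W A' ↑η else ∅) else ∅

/-- The empty event is determined by anything. [folklore] -/
theorem determinedBy_empty' (Kset : Set (Site 2)) : DeterminedBy (∅ : Set (Set (Site 2))) Kset := by
  rw [determinedBy_iff]; intro ω ω' _; simp

/-- A guard does not affect locality. [folklore] -/
theorem determinedBy_ite_empty {c : Prop} [Decidable c] {E : Set (Set (Site 2))} {Kset : Set (Site 2)}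
    (hE : c → DeterminedBy E Kset) : DeterminedBy (if c then E else ∅) Kset := by
  by_cases hc : c
  · rw [if_pos hc]; exact hE hc
  · rw [if_neg hc]; exact determinedBy_empty' _

/-- The inner half-box is disjoint from `U_{s,N}`. [folklore] -/
theorem disjoint_uSites_uInnerFinset (hs : 1 ≤ s) : Disjoint (uSites s N) (uInnerFinset s) := by
  rw [← Finset.disjoint_coe, coe_uInnerFinset hs, Set.disjoint_left]
  intro v hv hvI
  exact (mem_coe_uSites.1 hv).2 hvI

/-- `dataA` is an event of the inner half-box. [folklore] -/
theorem dataA_local (hs : 1 ≤ s) (T K M₀ K' M₁ : ℕ) (F η : Finset (Site 2)) :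
    ∃ H : Finset (Site 2), Disjoint F H ∧ DeterminedBy (dataA s N hs T K M₀ K' M₁ F η) ↑H := by
  classical
  by_cases hF : F = uSites s N
  · refine ⟨uInnerFinset s, hF ▸ disjoint_uSites_uInnerFinset hs, ?_⟩
    rw [dataA, if_pos hF, coe_uInnerFinset hs]
    exact determinedBy_ite_empty fun _ =>
      (determinedBy_FF_uInner K' M₁ _).inter (determinedBy_compl_mem (determinedBy_FF_uInner K' M₁ _))
  · refine ⟨∅, Finset.disjoint_empty_right _, ?_⟩
    rw [dataA, if_neg hF]
    exact determinedBy_empty' _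

/-- `dataB` is an event of the inner half-box (`2s ≤ N`, `1 ≤ W`, `2W + 1 ≤ s`, `2W ≤ A'`,
`A' + W + 1 ≤ s`). [folklore] -/
theorem dataB_local (hs : 1 ≤ s) (hN : 2 * s ≤ N) {W A' : ℕ} (hW : 1 ≤ W) (hWs : 2 * W + 1 ≤ s)
    (hWA' : 2 * W ≤ A') (hA's : A' + W + 1 ≤ s) (T K M₀ K' M₁ : ℕ) (F η : Finset (Site 2)) :
    ∃ H : Finset (Site 2), Disjoint F H ∧ DeterminedBy (dataB s N hs T K M₀ K' M₁ W A' F η) ↑H := by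
  classical
  by_cases hF : F = uSites s N
  · refine ⟨uInnerFinset s, hF ▸ disjoint_uSites_uInnerFinset hs, ?_⟩
    rw [dataB, if_pos hF, coe_uInnerFinset hs]
    refine determinedBy_ite_empty fun hZη => ?_
    obtain ⟨hlo, hlc, -⟩ := tips_of_zev hN hZη
    refine ((determinedBy_FF_uInner K' M₁ _).inter (determinedBy_compl_mem (determinedBy_FF_uInner K' M₁ _))).inter
      (DeterminedBy.inter ?_ ?_)
    · exact (determinedBy_corrOf hs (by omega) hW hWs hWA' hA's hlo _).mono inter_subset_left
    · exact determinedBy_compl_mem ((determinedBy_corrOf hs (by omega) hW hWs hWA' hA's hlc _).mono inter_subset_left)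
  · refine ⟨∅, Finset.disjoint_empty_right _, ?_⟩
    rw [dataB, if_neg hF]
    exact determinedBy_empty' _

/-- Agreement of a configuration with its trace on `U_{s,N}`. [folklore] -/
theorem agree_filter (ω : Set (Site 2)) [DecidablePred fun v => v ∈ ω] :
    ∀ v ∈ (↑(uSites s N) : Set (Site 2)),
      v ∈ (↑((uSites s N).filter fun v => v ∈ ω) : Set (Site 2)) ↔ v ∈ ω := by
  intro v hv
  rw [Finset.coe_filter]
  exact ⟨fun h0 => h0.2, fun h0 => ⟨hv, h0⟩⟩

/-- On the diagonal the data event `dataA` is `Zev ∩ {ω ∈ Aev ω}`. [folklore] -/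
theorem setOf_mem_dataA (hN : 2 * s ≤ N) (T K M₀ K' M₁ : ℕ) [∀ ω : Set (Site 2), DecidablePred fun v => v ∈ ω] :
    {ω : Set (Site 2) | ω ∈ dataA s N hs T K M₀ K' M₁ (uSites s N) ((uSites s N).filter fun v => v ∈ ω)} =
      Zev s N hs T K M₀ ∩ {ω | ω ∈ Aev s N hs K' M₁ ω} := by
  ext ω
  rw [mem_setOf_eq, dataA, if_pos rfl, mem_inter_iff, mem_setOf_eq, ← mem_zev_congr hN (agree_filter ω),
    ← aev_congr hN (agree_filter ω)]
  by_cases hZ : (↑((uSites s N).filter fun v => v ∈ ω) : Set (Site 2)) ∈ Zev s N hs T K M₀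
  · rw [if_pos hZ]; exact ⟨fun h0 => ⟨hZ, h0⟩, fun h0 => h0.2⟩
  · rw [if_neg hZ]; exact ⟨fun h0 => h0.elim, fun h0 => (hZ h0.1).elim⟩

/-- On the diagonal the data event `dataB` is `Zev ∩ {ω ∈ Bev ω}`. [folklore] -/
theorem setOf_mem_dataB (hN : 2 * s ≤ N) (T K M₀ K' M₁ W A' : ℕ) [∀ ω : Set (Site 2), DecidablePred fun v => v ∈ ω] :
    {ω : Set (Site 2) | ω ∈ dataB s N hs T K M₀ K' M₁ W A' (uSites s N) ((uSites s N).filter fun v => v ∈ ω)} =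
      Zev s N hs T K M₀ ∩ {ω | ω ∈ Bev s N hs K' M₁ W A' ω} := by
  ext ω
  rw [mem_setOf_eq, dataB, if_pos rfl, mem_inter_iff, mem_setOf_eq, ← mem_zev_congr hN (agree_filter ω),
    ← bev_congr hN (agree_filter ω)]
  by_cases hZ : (↑((uSites s N).filter fun v => v ∈ ω) : Set (Site 2)) ∈ Zev s N hs T K M₀
  · rw [if_pos hZ]; exact ⟨fun h0 => ⟨hZ, h0⟩, fun h0 => h0.2⟩
  · rw [if_neg hZ]; exact ⟨fun h0 => h0.elim, fun h0 => (hZ h0.1).elim⟩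

/-- **Separation of the selected tips on the frame event** (`tips_far_of_prot`, with the outer
boundary of `U_{s,2s}` far from the inner arc at all protection scales: `2 · 3^{K-1} M₀ ≤ s`). [cite: Nolin2008, §4.4, proof of Lemma 15 (arXiv 0711.4948: Lemma 14)] -/
theorem tips_far_of_zev {T K M₀ : ℕ} (hN : 2 * s ≤ N) (hM₀1 : 1 ≤ M₀) (hKM₀ : 2 * 3 ^ (K - 1) * M₀ ≤ s)
    {χ : Set (Site 2)} (hχ : χ ∈ Zev s N hs T K M₀) :
    ¬ TriQuad.InBox (scTip s N hs χ) M₀ (scTip s N hs χᶜ) := by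
  obtain ⟨⟨harm, harmc⟩, hT, hprot⟩ := hχ
  rw [mem_preimage] at harmc
  obtain ⟨hselo, huo⟩ := sel_selStage (hs := hs) hN harm
  obtain ⟨hselc, huc⟩ := sel_selStage (hs := hs) hN harmc
  rw [TriQuad.numStages_compl] at huc
  have hc' : (uQ s hs).LRPath (χᶜ \ ↑((uQ s hs).stages χ (selStage s N hs χᶜ))) := by
    have := hselc.1; rwa [TriQuad.stages_compl] at this
  have hgeom : ∀ l ∈ (uQ s hs).L, ∀ y ∈ (uQ s hs).R, ∀ i < K,
      y 0 ≤ l 0 - 2 * ((3 ^ i * M₀ : ℕ) : ℤ) ∨ l 0 + 2 * ((3 ^ i * M₀ : ℕ) : ℤ) ≤ y 0 ∨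
        y 1 ≤ l 1 - 2 * ((3 ^ i * M₀ : ℕ) : ℤ) ∨ l 1 + 2 * ((3 ^ i * M₀ : ℕ) : ℤ) ≤ y 1 := by
    intro l hl y hy i hi
    have hlL := (mem_uL_iff hs (by omega : s + 1 ≤ 2 * s)).1 hl
    obtain ⟨hyU, hy'⟩ := hy
    have hyb := (mem_coe_uSites.1 hyU).1
    have hr : 2 * ((3 ^ i * M₀ : ℕ) : ℤ) ≤ s := by
      have h3 : 3 ^ i ≤ 3 ^ (K - 1) := Nat.pow_le_pow_right (by norm_num) (by omega)
      have : 2 * (3 ^ i * M₀) ≤ s :=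
        calc 2 * (3 ^ i * M₀) ≤ 2 * (3 ^ (K - 1) * M₀) := by
              exact Nat.mul_le_mul_left _ (Nat.mul_le_mul_right _ h3)
          _ = 2 * 3 ^ (K - 1) * M₀ := by ring
          _ ≤ s := hKM₀
      exact_mod_cast this
    rcases hy' with h0 | h0 | h0 <;> omega
  exact TriQuad.tips_far_of_prot (Q := uQ s hs) hM₀1 hselo.1 hc' (hprot _ (by omega)).1 (hprot _ (by omega)).2 hgeom

/-- **Decoupling (Nolin's Lemma 12, summed over the data on `U`).** With `ε, ε'` the band
constants at `p` and `1 - p`, and the scale parameters as in `key_ineq` together with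
`2 · 3^{K-1} M₀ ≤ s`: `ε³ ε'³ · P_p(Zev ∩ {ω ∈ Aev ω}) ≤ P_p(Zev ∩ {ω ∈ Bev ω})`. Proof:
`mul_real_mem_dataEvent_le` for the constant stopping set `uSites s N` and the data events `dataA`,
`dataB` (events of the inner half-box); for data in `Zev` the tips are separated
(`tips_far_of_zev`) and `key_ineq` applies. [cite: Nolin2008, §4.3 Lemma 12, §4.4 proof of Lemma 15, §4.5 proof of Prop. 17 (arXiv 0711.4948: Lemma 11, Lemma 14, Prop. 16)] -/
theorem decoupling (p : unitInterval) {T K M₀ K' M₁ W A h j : ℕ} {δ₁ δ₂ δ₁' δ₂' : ℝ}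
    (hδ₁ : 0 ≤ δ₁) (hδ₂ : 0 ≤ δ₂) (h₁ : δ₁ ≤ triLRCrossingProb p (2 * h) h)
    (h₂ : δ₂ ≤ triLRCrossingProb p h h) (hδ₁' : 0 ≤ δ₁') (hδ₂' : 0 ≤ δ₂')
    (h₁' : δ₁' ≤ triLRCrossingProb (unitInterval.symm p) (2 * h) h)
    (h₂' : δ₂' ≤ triLRCrossingProb (unitInterval.symm p) h h) (hj : 1 ≤ j)
    (hWh : W = h + 1) (hjs : 2 * s ≤ (j + 1) * h) (hWA : W ≤ A) (hA : 2 * 3 ^ (K' - 1) * M₁ ≤ A)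
    (hM₀ : 2 * (A + W) + 2 * W + 2 ≤ M₀) (hsA : 4 * A + 2 * W + 8 ≤ s) (hN : 2 * s ≤ N)
    (hKM₀ : 2 * 3 ^ (K - 1) * M₀ ≤ s) :
    (δ₁ ^ j * δ₂ ^ (j - 1)) ^ 3 * (δ₁' ^ j * δ₂' ^ (j - 1)) ^ 3 *
        (triSitePercolation p).real (Zev s N hs T K M₀ ∩ {ω | ω ∈ Aev s N hs K' M₁ ω}) ≤
      (triSitePercolation p).real (Zev s N hs T K M₀ ∩ {ω | ω ∈ Bev s N hs K' M₁ W (A + W) ω}) := by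
  classical
  have hM₀1 : 1 ≤ M₀ := by omega
  have hW1 : 1 ≤ W := by omega
  -- the inequality for every value of the data
  have hAB : ∀ F η, (δ₁ ^ j * δ₂ ^ (j - 1)) ^ 3 * (δ₁' ^ j * δ₂' ^ (j - 1)) ^ 3 *
      (sitePercolation (Site 2) p).real (dataA s N hs T K M₀ K' M₁ F η) ≤
        (sitePercolation (Site 2) p).real (dataB s N hs T K M₀ K' M₁ W (A + W) F η) := by
    intro F η
    by_cases hF : F = uSites s N
    · rw [dataA, dataB, if_pos hF, if_pos hF]
      by_cases hZη : (↑η : Set (Site 2)) ∈ Zev s N hs T K M₀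
      · rw [if_pos hZη, if_pos hZη]
        obtain ⟨hlo, hlc, hne⟩ := tips_of_zev hN hZη
        have hfar := tips_far_of_zev (hs := hs) hN hM₀1 hKM₀ hZη
        have := key_ineq (hs := hs) (N := N) p hδ₁ hδ₂ h₁ h₂ hδ₁' hδ₂' h₁' h₂' hj hWh hjs hWA hA hM₀ hsA
          hlo hlc hne hfar
        unfold triSitePercolation at this
        exact this
      · simp only [if_neg hZη, measureReal_empty, mul_zero, le_refl]
    · simp only [dataA, dataB, if_neg hF, measureReal_empty, mul_zero, le_refl]
  have main := mul_real_mem_dataEvent_le p (G := uSites s N) (N := fun _ => uSites s N) (fun _ _ _ => rfl)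
    (fun _ => Finset.Subset.refl _) (dataA s N hs T K M₀ K' M₁) (dataB s N hs T K M₀ K' M₁ W (A + W))
    (dataA_local hs T K M₀ K' M₁) (dataB_local hs hN hW1 (by omega) (by omega) (by omega) T K M₀ K' M₁) hAB
  rw [setOf_mem_dataA hN, setOf_mem_dataB hN] at main
  unfold triSitePercolation
  exact main

/-- **Union bound over the window**: the probability that some `(x₀, 0)`, `|x₀| ≤ L`, is
`M'`-good for `ω` or for `ωᶜ` is at most `(2L + 1) (P_p(good) + P_{1-p}(good))` (translation
invariance `real_hpGood_shift`, colour exchange). [cite: WernerPCMI2009, Lecture 2, first exercise sheet ("Two-arm exponent in the half-plane", 2c)] -/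
theorem real_window_good_le (p : unitInterval) (M' : ℕ) (L : ℕ) :
    (triSitePercolation p).real (⋃ x₀ ∈ Finset.Icc (-(L : ℤ)) L, (hpGood M' ![x₀, 0] ∪ compl ⁻¹' hpGood M' ![x₀, 0])) ≤
      (2 * L + 1 : ℝ) * ((triSitePercolation p).real (hpGood M' 0) +
        (triSitePercolation (unitInterval.symm p)).real (hpGood M' 0)) := by
  have hx1 : ∀ x₀ : ℤ, (![x₀, 0] : Site 2) 1 = 0 := fun x₀ => rfl
  have hterm : ∀ x₀ : ℤ, (triSitePercolation p).real (hpGood M' ![x₀, 0] ∪ compl ⁻¹' hpGood M' ![x₀, 0]) ≤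
      (triSitePercolation p).real (hpGood M' 0) + (triSitePercolation (unitInterval.symm p)).real (hpGood M' 0) := by
    intro x₀
    refine (measureReal_union_le _ _).trans ?_
    have e1 := real_hpGood_shift p M' (hx1 x₀)
    have e2 := real_hpGood_shift (unitInterval.symm p) M' (hx1 x₀)
    unfold triSitePercolation at e1 e2 ⊢
    rw [sitePercolation_real_preimage_compl, e1, e2]
  have hcard : ((Finset.Icc (-(L : ℤ)) L).card : ℝ) = 2 * L + 1 := by
    have : (Finset.Icc (-(L : ℤ)) L).card = 2 * L + 1 := by
      rw [Int.card_Icc]; omega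
    rw [this]; push_cast; ring
  calc (triSitePercolation p).real (⋃ x₀ ∈ Finset.Icc (-(L : ℤ)) L, (hpGood M' ![x₀, 0] ∪ compl ⁻¹' hpGood M' ![x₀, 0]))
      ≤ ∑ x₀ ∈ Finset.Icc (-(L : ℤ)) L, (triSitePercolation p).real (hpGood M' ![x₀, 0] ∪ compl ⁻¹' hpGood M' ![x₀, 0]) :=
        measureReal_biUnion_finset_le _ _
    _ ≤ ∑ _x₀ ∈ Finset.Icc (-(L : ℤ)) L, ((triSitePercolation p).real (hpGood M' 0) +
          (triSitePercolation (unitInterval.symm p)).real (hpGood M' 0)) := Finset.sum_le_sum fun x₀ _ => hterm x₀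
    _ = _ := by rw [Finset.sum_const, nsmul_eq_mul, hcard]

/-- **On the frame and the corridors there is a good or anti-good window point.** [cite: Nolin2008, §4.5, proof of Prop. 17 (arXiv 0711.4948: Prop. 16)] -/
theorem zev_bev_subset {T K M₀ K' M₁ W A M' : ℕ} (hNM : N = 2 * M') (hN : 2 * s ≤ N) (hW : 2 ≤ W)
    (hWM : W ≤ M₁) (hA : 2 * 3 ^ (K' - 1) * M₁ ≤ A) (hsA : 4 * A + 2 * W + 8 ≤ s) (hM' : s + A + 1 < M') :
    Zev s N hs T K M₀ ∩ {ω | ω ∈ Bev s N hs K' M₁ W (A + W) ω} ⊆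
      ⋃ x₀ ∈ Finset.Icc (-((s + A : ℕ) : ℤ)) (s + A : ℕ), (hpGood M' ![x₀, 0] ∪ compl ⁻¹' hpGood M' ![x₀, 0]) := by
  intro ω hω
  -- (membership in the set-builder is rewritten explicitly: the kernel must not unfold `Bev`)
  rw [mem_inter_iff, mem_setOf_eq] at hω
  obtain ⟨⟨⟨harm, harmc⟩, -⟩, hB'⟩ := hω
  rw [mem_preimage] at harmc
  obtain ⟨x₀, h1, h2, h3⟩ := exists_goodPoint (hs := hs) hNM hN hW hWM hA hsA hM' harm harmc hB'
  have hsA' : ((s + A : ℕ) : ℤ) = (s : ℤ) + A := by push_cast; ring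
  have hx : x₀ ∈ Finset.Icc (-((s + A : ℕ) : ℤ)) (s + A : ℕ) := by
    rw [Finset.mem_Icc, hsA']; exact ⟨h1, h2⟩
  exact mem_iUnion₂.2 ⟨x₀, hx, h3⟩

/-- **The bound of one scale by good points.** Under the hypotheses of `decoupling`, with
`N = 2M'` and `s + A + 1 < M'`:
`ε³ ε'³ · P_p(Zev ∩ {ω ∈ Aev ω}) ≤ (2(s + A) + 1) · (P_p(x is M'-good) + P_{1-p}(x is M'-good))`. [cite: Nolin2008, §4.5, proof of Prop. 17 (arXiv 0711.4948: Prop. 16)] [cite: KestenScalingCMP1987, Lemma 4] -/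
theorem real_zev_aev_le (p : unitInterval) {T K M₀ K' M₁ W A h j M' : ℕ} {δ₁ δ₂ δ₁' δ₂' : ℝ}
    (hδ₁ : 0 ≤ δ₁) (hδ₂ : 0 ≤ δ₂) (h₁ : δ₁ ≤ triLRCrossingProb p (2 * h) h)
    (h₂ : δ₂ ≤ triLRCrossingProb p h h) (hδ₁' : 0 ≤ δ₁') (hδ₂' : 0 ≤ δ₂')
    (h₁' : δ₁' ≤ triLRCrossingProb (unitInterval.symm p) (2 * h) h)
    (h₂' : δ₂' ≤ triLRCrossingProb (unitInterval.symm p) h h) (hj : 1 ≤ j)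
    (hWh : W = h + 1) (hjs : 2 * s ≤ (j + 1) * h) (hW : 2 ≤ W) (hWM : W ≤ M₁) (hWA : W ≤ A)
    (hA : 2 * 3 ^ (K' - 1) * M₁ ≤ A) (hM₀ : 2 * (A + W) + 2 * W + 2 ≤ M₀) (hsA : 4 * A + 2 * W + 8 ≤ s)
    (hN : 2 * s ≤ N) (hKM₀ : 2 * 3 ^ (K - 1) * M₀ ≤ s) (hNM : N = 2 * M') (hM' : s + A + 1 < M') :
    (δ₁ ^ j * δ₂ ^ (j - 1)) ^ 3 * (δ₁' ^ j * δ₂' ^ (j - 1)) ^ 3 *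
        (triSitePercolation p).real (Zev s N hs T K M₀ ∩ {ω | ω ∈ Aev s N hs K' M₁ ω}) ≤
      (2 * (s + A : ℕ) + 1 : ℝ) * ((triSitePercolation p).real (hpGood M' 0) +
        (triSitePercolation (unitInterval.symm p)).real (hpGood M' 0)) := by
  refine (decoupling (hs := hs) p hδ₁ hδ₂ h₁ h₂ hδ₁' hδ₂' h₁' h₂' hj hWh hjs hWA hA hM₀ hsA hN hKM₀).trans ?_
  refine le_trans ?_ (real_window_good_le p M' (s + A))
  exact measureReal_mono (zev_bev_subset (hs := hs) hNM hN hW hWM hA hsA hM') (measure_ne_top _ _)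

end Probability

end Literature.Probability.Percolation
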